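import Literature.AlgebraicGeometry.Frobenioids.ArchimedeanAngloidIrreduciblesR
import Literature.AlgebraicGeometry.Frobenioids.ArchimedeanProp35iiiCounterexample
import Literature.AlgebraicGeometry.Frobenioids.ArchimedeanQuotientLiftingLinear
import HarnessLib

/-!
# Frobenioids II, Proposition 3.5 (iii) REPAIRED for the non-rigidified angloid `N`: ANCHOR TRANSFER
# along `N ⊆ A ⊆ C = C₀ ×_{D₀} D → D` and `N` of RC-iso-subanchor type under Galois saturation

Mochizuki, *The geometry of Frobenioids II: poly-Frobenioids*, Kyushu J. Math. **62** (2008) 401–460,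
§3, Proposition 3.5 (iii) p. 34, proof p. 35 ll. 28–40 [cite: MochizukiFrdII2008, Prop 3.5 (iii) p.34].

For `N` the typed instance `ArchFrd.Prop35iii_N` is FALSE in general (`ArchFrd.not_prop35iii_N_collapse`,
`ArchimedeanProp35iiiCounterexample.lean`: the lifted quotient needs a Galois-saturated quotient datum in
`D`). This PROOF-ONLY file proves the REPAIRED form — row G-w4d027-1 of the cell's GAP-LEDGER — with the
repair written as an explicit hypothesis (no new definition): if every object of `D` admits a presentation
as a mono-minimal categorical quotient of an RC-subanchor by a GALOIS-SATURATED group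
(`ArchFrd.GaloisSaturated`, abc-iut-w4-d100), then `N` is of RC-iso-subanchor type
(**`prop35iii_N_of_saturated`**). Ingredients, parallel to the `R`-files
(`ArchimedeanAngloidAnchorsR.lean`, `ArchimedeanAngloidIrreduciblesR.lean`):

* the two kinds of irreducible arrows of `N[ℂ]` (`N.fst_isIso_or_snd_isIso_of_irreducible`), the first
  kind pulled back from `D[ℂ]` (`N.irreducible_snd_of_irreducible`, `N.nonempty_under_iso`), the second
  kind landing in isotropic objects and unique up to isomorphism under the source
  (`N.isNaivelyIsotropic_of_irreducible`, via `C0.exists_fac_of_not_isotropic` = [FrdII] Lem. 3.2 (vii));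
* **`N.isRCAnchor_of_isRCAnchor_base`** — an object of `N` over an RC-anchor of `D` is an RC-anchor of `N`
  (every base `π`; `AnchorCriteria.isAnchor_of_kinds` / `finite_isoClasses_of_functor`);
* the lift of [FrdII] Prop. 3.5 (i) for `N` under saturation (abc-iut-w4-d100's `QuotientLiftN`,
  `ArchimedeanQuotientLiftingLinear.lean`) is an RC-subanchor (`N.isRCSubanchor_liftObjN`), whence the
  repaired (iii) **`prop35iii_N_of_saturated`**.

No definitions; nothing re-typed; nothing here bears on [IUTchIII] Cor. 3.12. Seat abc-iut-w4-d027 (gen 2),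
sub-DAG row P35-L06 (N-half, repaired).
-/

namespace Literature.AlgebraicGeometry.Frobenioids

open CategoryTheory
open scoped Pointwise

noncomputable section

namespace ArchFrd

universe v u

variable {D : Type u} [Category.{v} D] (π : D ⥤ D0)

/-! ### Complex objects and componentwise criteria for `N` -/

/-- An object `X` of `N` is complex for the RC-structure `N → C → D → D₀` iff `π(X_D) = Spec ℂ`.
[cite: MochizukiFrdII2008, Def 3.1 (v) p.24] -/
theorem N.complexObjects_iff (X : N π) :
    RC.complexObjects (N.toC π ⋙ PreFrobenioid.baseFunctor (C.toElem π) ⋙ baseRC π) X ↔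
      (π.obj X.obj.obj.snd).IsComplex :=
  D0.isComplex_toArchBase_iff _

/-- For a complex object `X` of `N`, the base of its `C₀`-component is `Spec ℂ`.
[cite: MochizukiFrdII2008, Def 3.1 (v) p.24] -/
theorem N.isComplex_fst_base (X : N π) (h : (π.obj X.obj.obj.snd).IsComplex) :
    X.obj.obj.fst.base.IsComplex :=
  D0.eq_complex_of_hom_complex (X.obj.obj.iso.hom ≫ eqToHom h)

/-- Two arrows of `C` with the same domain and the same `C₀`-divisor have the same `Div`; in particular an
arrow whose `C₀`-component is an isometry of `C₀` is an isometry of `C`.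
[cite: MochizukiFrdII2008, Ex 3.3 (iii) p.28] -/
theorem C.isIsometry_of_div_fst_eq {X Y Y' : C π} (k : X ⟶ Y) (k' : X ⟶ Y')
    (h : C0.div k'.fst = C0.div k.fst) (hk : PreFrobenioid.IsIsometry (C.toElem π) k) :
    PreFrobenioid.IsIsometry (C.toElem π) k' := by
  have e : PreFrobenioid.Div C0.toElem k'.fst = PreFrobenioid.Div C0.toElem k.fst := h
  change PreFrobenioid.Div (C.toElem π) k' = 1
  rw [PreFrobenioid.fiberProduct_div, e, ← PreFrobenioid.fiberProduct_div]
  exact hk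

/-- An arrow of `C` whose `C₀`-component has `Div = 0` is an isometry of `C`.
[cite: MochizukiFrdII2008, Ex 3.3 (iii) p.28] -/
theorem C.isIsometry_of_div_fst_eq_one {X Y : C π} (k : X ⟶ Y) (h : C0.div k.fst = 1) :
    PreFrobenioid.IsIsometry (C.toElem π) k :=
  C.isIsometry_of_div_fst_eq π (𝟙 X) k (h.trans (C0.div_id X.fst).symm) (PreFrobenioid.div_id _ X)

/-! ### The two kinds of irreducible arrows of `N[ℂ]` -/

section Kinds

variable {π}

/-- **An irreducible arrow `φ = (φ₀, φ_D)` of `N[ℂ]` has `φ₀` invertible or `φ_D` invertible** (it factors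
through the complex object `(cod φ₀, dom φ_D)` as `(φ₀, id) ≫ (id, φ_D)`, both factors linear isometries).
[cite: MochizukiFrdII2008, Prop 3.5 (iii) p.34] -/
theorem N.fst_isIso_or_snd_isIso_of_irreducible
    {A B : RC.ComplexPart (N.toC π ⋙ PreFrobenioid.baseFunctor (C.toElem π) ⋙ baseRC π)}
    (f : A ⟶ B) (hf : IsIrreducibleHom f) : IsIso f.hom.hom.hom.fst ∨ IsIso f.hom.hom.hom.snd := by
  have hB : (π.obj B.obj.obj.obj.snd).IsComplex := (N.complexObjects_iff π B.obj).mp B.property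
  haveI : IsIso (C0.Base f.hom.hom.hom.fst) :=
    D0.isIso_of_isComplex_target _ (N.isComplex_fst_base π B.obj hB)
  set fC := f.hom.hom.hom with hfC
  have hw : C0.Base fC.fst ≫ (QuotientLift.baseIso π B.obj.obj.obj).hom =
      (QuotientLift.baseIso π A.obj.obj.obj).hom ≫ π.map fC.snd := fC.w
  let M : C π := ⟨B.obj.obj.obj.fst, A.obj.obj.obj.snd,
    (asIso (C0.Base fC.fst)).symm ≪≫ QuotientLift.baseIso π A.obj.obj.obj⟩
  let b : A.obj.obj.obj ⟶ M := ⟨fC.fst, 𝟙 _, by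
    change C0.Base fC.fst ≫ (inv (C0.Base fC.fst) ≫ (QuotientLift.baseIso π A.obj.obj.obj).hom) =
      (QuotientLift.baseIso π A.obj.obj.obj).hom ≫ π.map (𝟙 _)
    rw [IsIso.hom_inv_id_assoc, CategoryTheory.Functor.map_id, Category.comp_id]⟩
  let a : M ⟶ B.obj.obj.obj := ⟨𝟙 _, fC.snd, by
    change C0.Base (𝟙 _) ≫ (QuotientLift.baseIso π B.obj.obj.obj).hom =
      (inv (C0.Base fC.fst) ≫ (QuotientLift.baseIso π A.obj.obj.obj).hom) ≫ π.map fC.snd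
    rw [C0.base_id', Category.id_comp, Category.assoc, ← hw, IsIso.inv_hom_id_assoc]⟩
  have hb : PreFrobenioid.isometricMorphisms (C.toElem π) b :=
    C.isIsometry_of_div_fst_eq π fC b rfl f.hom.hom.property
  have ha : PreFrobenioid.isometricMorphisms (C.toElem π) a :=
    C.isIsometry_of_div_fst_eq_one π a (C0.div_id _)
  let bN : A.obj ⟶ (⟨⟨M⟩⟩ : N π) := ⟨⟨b, hb⟩, f.hom.property⟩
  let aN : (⟨⟨M⟩⟩ : N π) ⟶ B.obj := ⟨⟨a, ha⟩, C0.degFr_id' B.obj.obj.obj.fst⟩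
  have hM : RC.complexObjects (N.toC π ⋙ PreFrobenioid.baseFunctor (C.toElem π) ⋙ baseRC π) ⟨⟨M⟩⟩ :=
    (N.complexObjects_iff π _).mpr ((N.complexObjects_iff π A.obj).mp A.property)
  have hfac : (ObjectProperty.homMk bN : A ⟶ ⟨⟨⟨M⟩⟩, hM⟩) ≫ ObjectProperty.homMk aN = f := by
    apply InducedCategory.hom_ext
    apply N.hom_ext'
    change b ≫ a = fC
    exact CFP.hom_ext (Category.comp_id _) (Category.id_comp _)
  rcases hf.2 _ _ hfac with h | h
  · right
    haveI : IsIso aN := (ObjectProperty.isIso_hom_iff _).mpr h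
    haveI : IsIso a := (inferInstance : IsIso ((N.toC π).map aN))
    exact CFP.isIso_snd a
  · left
    haveI : IsIso bN := (ObjectProperty.isIso_hom_iff _).mpr h
    haveI : IsIso b := (inferInstance : IsIso ((N.toC π).map bN))
    exact CFP.isIso_fst b

/-- **First kind**: if `φ` is irreducible in `N[ℂ]` with `φ₀` invertible, then `φ_D` is irreducible in
`D[ℂ]`. [cite: MochizukiFrdII2008, Prop 3.5 (iii) p.34] -/
theorem N.irreducible_snd_of_irreducible
    {A B : RC.ComplexPart (N.toC π ⋙ PreFrobenioid.baseFunctor (C.toElem π) ⋙ baseRC π)}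
    (f : A ⟶ B) (hf : IsIrreducibleHom f) [IsIso f.hom.hom.hom.fst] :
    IsIrreducibleHom
      (ObjectProperty.homMk f.hom.hom.hom.snd :
        (⟨A.obj.obj.obj.snd, A.property⟩ : RC.ComplexPart (baseRC π)) ⟶ ⟨B.obj.obj.obj.snd, B.property⟩) := by
  have hB : (π.obj B.obj.obj.obj.snd).IsComplex := (N.complexObjects_iff π B.obj).mp B.property
  set fC := f.hom.hom.hom with hfC
  refine ⟨fun hiso => hf.1 ?_, fun Z β α hβα => ?_⟩
  · haveI : IsIso fC.snd := (ObjectProperty.isIso_hom_iff _).mpr hiso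
    haveI : IsIso fC := CFP.isIso_of_isIso_fst_snd fC
    haveI : IsIso f.hom := N.isIso_of_isIso_hom f.hom
    exact (ObjectProperty.isIso_hom_iff _).mp inferInstance
  · have hZ : (π.obj Z.obj).IsComplex := (D0.isComplex_toArchBase_iff _).mp Z.property
    have hcomp : β.hom ≫ α.hom = fC.snd := congrArg InducedCategory.Hom.hom hβα
    haveI : IsIso (π.map α.hom) := D0.isIso_of_isComplex_target _ hB
    have hw : C0.Base fC.fst ≫ (QuotientLift.baseIso π B.obj.obj.obj).hom =
        (QuotientLift.baseIso π A.obj.obj.obj).hom ≫ π.map fC.snd := fC.w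
    let M : C π := ⟨B.obj.obj.obj.fst, Z.obj,
      QuotientLift.baseIso π B.obj.obj.obj ≪≫ (asIso (π.map α.hom)).symm⟩
    let b : A.obj.obj.obj ⟶ M := ⟨fC.fst, β.hom, by
      change C0.Base fC.fst ≫ ((QuotientLift.baseIso π B.obj.obj.obj).hom ≫ inv (π.map α.hom)) =
        (QuotientLift.baseIso π A.obj.obj.obj).hom ≫ π.map β.hom
      rw [← Category.assoc, hw, ← hcomp, CategoryTheory.Functor.map_comp, Category.assoc,
        Category.assoc, IsIso.hom_inv_id, Category.comp_id]⟩
    let a : M ⟶ B.obj.obj.obj := ⟨𝟙 _, α.hom, by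
      change C0.Base (𝟙 _) ≫ (QuotientLift.baseIso π B.obj.obj.obj).hom =
        ((QuotientLift.baseIso π B.obj.obj.obj).hom ≫ inv (π.map α.hom)) ≫ π.map α.hom
      rw [C0.base_id', Category.id_comp, Category.assoc, IsIso.inv_hom_id, Category.comp_id]⟩
    have hb : PreFrobenioid.isometricMorphisms (C.toElem π) b :=
      C.isIsometry_of_div_fst_eq π fC b rfl f.hom.hom.property
    have ha : PreFrobenioid.isometricMorphisms (C.toElem π) a :=
      C.isIsometry_of_div_fst_eq_one π a (C0.div_id _)
    let bN : A.obj ⟶ (⟨⟨M⟩⟩ : N π) := ⟨⟨b, hb⟩, f.hom.property⟩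
    let aN : (⟨⟨M⟩⟩ : N π) ⟶ B.obj := ⟨⟨a, ha⟩, C0.degFr_id' B.obj.obj.obj.fst⟩
    have hM : RC.complexObjects (N.toC π ⋙ PreFrobenioid.baseFunctor (C.toElem π) ⋙ baseRC π) ⟨⟨M⟩⟩ :=
      (N.complexObjects_iff π _).mpr hZ
    have hfac : (ObjectProperty.homMk bN : A ⟶ ⟨⟨⟨M⟩⟩, hM⟩) ≫ ObjectProperty.homMk aN = f := by
      apply InducedCategory.hom_ext
      apply N.hom_ext'
      change b ≫ a = fC
      exact CFP.hom_ext (Category.comp_id _) hcomp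
    rcases hf.2 _ _ hfac with h | h
    · left
      haveI : IsIso aN := (ObjectProperty.isIso_hom_iff _).mpr h
      haveI : IsIso a := (inferInstance : IsIso ((N.toC π).map aN))
      haveI : IsIso a.snd := CFP.isIso_snd a
      exact (ObjectProperty.isIso_hom_iff _).mp (show IsIso α.hom from inferInstance)
    · right
      haveI : IsIso bN := (ObjectProperty.isIso_hom_iff _).mpr h
      haveI : IsIso b := (inferInstance : IsIso ((N.toC π).map bN))
      haveI : IsIso b.snd := CFP.isIso_snd b
      exact (ObjectProperty.isIso_hom_iff _).mp (show IsIso β.hom from inferInstance)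

/-- **Second kind**: an irreducible arrow of `N[ℂ]` with invertible `D`-component lands in an object whose
angular region is ISOTROPIC (otherwise the factorisation `C0.exists_fac_of_not_isotropic` of its
`C₀`-component — [FrdII] Lem. 3.2 (vii) — lifts to `N[ℂ]` with neither factor invertible), and its
`C₀`-component is not invertible. [cite: MochizukiFrdII2008, Prop 3.5 (iii) p.34] -/
theorem N.isNaivelyIsotropic_of_irreducible
    {A B : RC.ComplexPart (N.toC π ⋙ PreFrobenioid.baseFunctor (C.toElem π) ⋙ baseRC π)}
    (f : A ⟶ B) (hf : IsIrreducibleHom f) [IsIso f.hom.hom.hom.snd] :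
    B.obj.obj.obj.fst.IsNaivelyIsotropic ∧ ¬ IsIso f.hom.hom.hom.fst := by
  have hA : (π.obj A.obj.obj.obj.snd).IsComplex := (N.complexObjects_iff π A.obj).mp A.property
  have hB : (π.obj B.obj.obj.obj.snd).IsComplex := (N.complexObjects_iff π B.obj).mp B.property
  set fC := f.hom.hom.hom with hfC
  have hnot : ¬ IsIso fC.fst := by
    intro h
    haveI : IsIso fC := CFP.isIso_of_isIso_fst_snd fC
    haveI : IsIso f.hom := N.isIso_of_isIso_hom f.hom
    exact hf.1 ((ObjectProperty.isIso_hom_iff _).mp inferInstance)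
  refine ⟨?_, hnot⟩
  by_contra hBi
  have hdeg : C0.degFr fC.fst = 1 := f.hom.property
  have hiso : ‖(C0.scalar fC.fst : ℂ)‖ * A.obj.obj.obj.fst.tip = B.obj.obj.obj.fst.tip := by
    have h := (A0.isIsometry_iff_norm_mul_tip_pow fC.fst).mp
      ((PreFrobenioid.isIsometry_fiberProduct_iff _).1 f.hom.hom.property)
    rwa [hdeg, PNat.one_coe, pow_one] at h
  obtain ⟨M, m₁, m₂, -, hd₁, hd₂, hi₁, hi₂, hfac, hm₁, hm₂⟩ :=
    C0.exists_fac_of_not_isotropic fC.fst (N.isComplex_fst_base π B.obj hB) hdeg hiso hnot hBi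
  have h₁ : PreFrobenioid.IsIsometry C0.toElem m₁ :=
    (A0.isIsometry_iff_norm_mul_tip_pow m₁).mpr (by rw [hd₁, PNat.one_coe, pow_one]; exact hi₁)
  have h₂ : PreFrobenioid.IsIsometry C0.toElem m₂ :=
    (A0.isIsometry_iff_norm_mul_tip_pow m₂).mpr (by rw [hd₂, PNat.one_coe, pow_one]; exact hi₂)
  -- `M` lies over `Spec ℂ` (it maps to `B₀`), so `Base m₁` is invertible
  have hMc : M.base.IsComplex :=
    D0.eq_complex_of_hom_complex (C0.Base m₂ ≫ eqToHom (N.isComplex_fst_base π B.obj hB))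
  haveI : IsIso (C0.Base m₁) := D0.isIso_of_isComplex_target _ hMc
  have hw : C0.Base fC.fst ≫ (QuotientLift.baseIso π B.obj.obj.obj).hom =
      (QuotientLift.baseIso π A.obj.obj.obj).hom ≫ π.map fC.snd := fC.w
  let MC : C π := ⟨M, A.obj.obj.obj.snd, (asIso (C0.Base m₁)).symm ≪≫ QuotientLift.baseIso π A.obj.obj.obj⟩
  let b : A.obj.obj.obj ⟶ MC := ⟨m₁, 𝟙 _, by
    change C0.Base m₁ ≫ (inv (C0.Base m₁) ≫ (QuotientLift.baseIso π A.obj.obj.obj).hom) =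
      (QuotientLift.baseIso π A.obj.obj.obj).hom ≫ π.map (𝟙 _)
    rw [IsIso.hom_inv_id_assoc, CategoryTheory.Functor.map_id, Category.comp_id]⟩
  let a : MC ⟶ B.obj.obj.obj := ⟨m₂, fC.snd, by
    change C0.Base m₂ ≫ (QuotientLift.baseIso π B.obj.obj.obj).hom =
      (inv (C0.Base m₁) ≫ (QuotientLift.baseIso π A.obj.obj.obj).hom) ≫ π.map fC.snd
    rw [Category.assoc, ← hw, ← hfac, C0.base_comp', Category.assoc, IsIso.inv_hom_id_assoc]⟩
  have hb : PreFrobenioid.isometricMorphisms (C.toElem π) b := C.isIsometry_of_div_fst_eq_one π b h₁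
  have ha : PreFrobenioid.isometricMorphisms (C.toElem π) a := C.isIsometry_of_div_fst_eq_one π a h₂
  let bN : A.obj ⟶ (⟨⟨MC⟩⟩ : N π) := ⟨⟨b, hb⟩, hd₁⟩
  let aN : (⟨⟨MC⟩⟩ : N π) ⟶ B.obj := ⟨⟨a, ha⟩, hd₂⟩
  have hM : RC.complexObjects (N.toC π ⋙ PreFrobenioid.baseFunctor (C.toElem π) ⋙ baseRC π) ⟨⟨MC⟩⟩ :=
    (N.complexObjects_iff π _).mpr hA
  have hfac' : (ObjectProperty.homMk bN : A ⟶ ⟨⟨⟨MC⟩⟩, hM⟩) ≫ ObjectProperty.homMk aN = f := by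
    apply InducedCategory.hom_ext
    apply N.hom_ext'
    change b ≫ a = fC
    exact CFP.hom_ext hfac (Category.id_comp _)
  rcases hf.2 _ _ hfac' with h | h
  · haveI : IsIso aN := (ObjectProperty.isIso_hom_iff _).mpr h
    haveI : IsIso a := (inferInstance : IsIso ((N.toC π).map aN))
    exact hm₂ (CFP.isIso_fst a)
  · haveI : IsIso bN := (ObjectProperty.isIso_hom_iff _).mpr h
    haveI : IsIso b := (inferInstance : IsIso ((N.toC π).map bN))
    exact hm₁ (CFP.isIso_fst b)

/-- **Isomorphism under `X` from the components** (as for `R`): two arrows `f, g` out of `X` in `N[ℂ]`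
with an isomorphism `t₀` of `C₀` between the codomains' `C₀`-components, a linear isometry, and an
isomorphism `t₁` of `D` between their `D`-components, compatible with `f`, `g`, are isomorphic under `X`.
[cite: MochizukiFrdII2008, Prop 3.5 (iii) p.34] -/
theorem N.nonempty_under_iso
    {A : RC.ComplexPart (N.toC π ⋙ PreFrobenioid.baseFunctor (C.toElem π) ⋙ baseRC π)}
    (f g : Under A) (t₀ : f.right.obj.obj.obj.fst ≅ g.right.obj.obj.obj.fst)
    (ht₀ : f.hom.hom.hom.hom.fst ≫ t₀.hom = g.hom.hom.hom.hom.fst)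
    (hiso₀ : PreFrobenioid.IsIsometry C0.toElem t₀.hom) (hlin₀ : C0.degFr t₀.hom = 1)
    (t₁ : f.right.obj.obj.obj.snd ≅ g.right.obj.obj.obj.snd)
    (ht₁ : f.hom.hom.hom.hom.snd ≫ t₁.hom = g.hom.hom.hom.hom.snd) : Nonempty (f ≅ g) := by
  have hfr : (π.obj f.right.obj.obj.obj.snd).IsComplex :=
    (N.complexObjects_iff π f.right.obj).mp f.right.property
  haveI : IsIso (C0.Base f.hom.hom.hom.hom.fst) :=
    D0.isIso_of_isComplex_target _ (N.isComplex_fst_base π f.right.obj hfr)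
  have hwf : C0.Base f.hom.hom.hom.hom.fst ≫ (QuotientLift.baseIso π f.right.obj.obj.obj).hom =
      (QuotientLift.baseIso π A.obj.obj.obj).hom ≫ π.map f.hom.hom.hom.hom.snd := f.hom.hom.hom.hom.w
  have hwg : C0.Base g.hom.hom.hom.hom.fst ≫ (QuotientLift.baseIso π g.right.obj.obj.obj).hom =
      (QuotientLift.baseIso π A.obj.obj.obj).hom ≫ π.map g.hom.hom.hom.hom.snd := g.hom.hom.hom.hom.w
  have w : C0.Base t₀.hom ≫ (QuotientLift.baseIso π g.right.obj.obj.obj).hom =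
      (QuotientLift.baseIso π f.right.obj.obj.obj).hom ≫ π.map t₁.hom := by
    rw [← cancel_epi (C0.Base f.hom.hom.hom.hom.fst), ← Category.assoc, ← C0.base_comp', ht₀,
      hwg, ← ht₁, CategoryTheory.Functor.map_comp, ← Category.assoc, ← hwf, Category.assoc]
  let t : f.right.obj.obj.obj ≅ g.right.obj.obj.obj := CFP.isoMk t₀ t₁ w
  have ht : PreFrobenioid.isometricMorphisms (C.toElem π) t.hom := C.isIsometry_of_div_fst_eq_one π _ hiso₀
  let tN : f.right.obj ⟶ g.right.obj := ⟨⟨t.hom, ht⟩, hlin₀⟩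
  haveI : IsIso tN := by
    haveI : IsIso tN.hom.hom := t.isIso_hom
    exact N.isIso_of_isIso_hom tN
  refine ⟨Under.isoMk (ObjectProperty.isoMk _ (asIso tN)) ?_⟩
  apply InducedCategory.hom_ext
  apply N.hom_ext'
  change f.hom.hom.hom.hom ≫ t.hom = g.hom.hom.hom.hom
  exact CFP.hom_ext ht₀ ht₁

end Kinds

/-! ### The anchor transfer for `N` -/

/-- **An object of `N` lying over an RC-anchor of `D` is an RC-anchor of `N`**, for every base
`π : D → D₀` ([FrdII] proof of Prop. 3.5 (iii), p. 35 ll. 28–40): the irreducible arrows of `N[ℂ]` out of it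
are of the pull-back kind `(iso, φ_D)` — finitely many classes, pulled back from the anchor `X_D` along
`N[ℂ] → D[ℂ]` — or of the isometric-pre-step kind `(φ₀, iso)` with isotropic codomain — one class.
[cite: MochizukiFrdII2008, Prop 3.5 (iii) p.34] -/
theorem N.isRCAnchor_of_isRCAnchor_base (X : N π) (hX : RC.IsRCAnchor (baseRC π) X.obj.obj.snd) :
    RC.IsRCAnchor (N.toC π ⋙ PreFrobenioid.baseFunctor (C.toElem π) ⋙ baseRC π) X := by
  obtain ⟨hc, hanch⟩ := hX
  have hcN : RC.complexObjects (N.toC π ⋙ PreFrobenioid.baseFunctor (C.toElem π) ⋙ baseRC π) X :=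
    (N.complexObjects_iff π X).mpr ((D0.isComplex_toArchBase_iff _).mp hc)
  refine ⟨hcN, ?_⟩
  let PN := N.toC π ⋙ PreFrobenioid.baseFunctor (C.toElem π) ⋙ baseRC π
  let A : RC.ComplexPart PN := ⟨X, hcN⟩
  let Ψ : RC.ComplexPart PN ⥤ RC.ComplexPart (baseRC π) :=
    (RC.complexObjects (baseRC π)).lift ((RC.complexObjects PN).ι ⋙ N.toBase π) fun Y => Y.property
  refine isAnchor_of_kinds A (fun Y φ => IsIso φ.hom.hom.hom.fst ∧ IsIrreducibleHom φ)
    (fun Y φ => IsIso φ.hom.hom.hom.snd ∧ IsIrreducibleHom φ)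
    (fun Y φ hφ => (N.fst_isIso_or_snd_isIso_of_irreducible φ hφ).imp (fun h => ⟨h, hφ⟩) fun h => ⟨h, hφ⟩)
    ?_ ?_
  · -- first kind: finiteness pulled back along `Ψ` from the anchor `X_D` of `D[ℂ]`
    refine finite_isoClasses_of_functor Ψ A (fun Y φ => IsIso φ.hom.hom.hom.fst ∧ IsIrreducibleHom φ)
      ?_ ?_ hanch
    · rintro Y φ ⟨hφ₁, hφ⟩
      haveI := hφ₁
      exact N.irreducible_snd_of_irreducible φ hφ
    · rintro f g ⟨hf₁, -⟩ ⟨hg₁, -⟩ ⟨e⟩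
      haveI := hf₁
      haveI := hg₁
      have hw : f.hom.hom.hom.hom.snd ≫ e.hom.right.hom = g.hom.hom.hom.hom.snd :=
        congrArg InducedCategory.Hom.hom (Under.w e.hom)
      haveI : IsIso (inv f.hom.hom.hom.hom.fst ≫ g.hom.hom.hom.hom.fst) := inferInstance
      refine N.nonempty_under_iso f g ((asIso f.hom.hom.hom.hom.fst).symm ≪≫ asIso g.hom.hom.hom.hom.fst)
        (by rw [Iso.trans_hom, Iso.symm_hom, asIso_inv, asIso_hom, IsIso.hom_inv_id_assoc]) ?_ ?_
        ((RC.complexObjects (baseRC π)).ι.mapIso ((Under.forget _).mapIso e)) hw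
      · change PreFrobenioid.IsIsometry C0.toElem (inv f.hom.hom.hom.hom.fst ≫ g.hom.hom.hom.hom.fst)
        have h1 : PreFrobenioid.IsIsometry C0.toElem (inv f.hom.hom.hom.hom.fst) := C0.isIsometry_inv _
        have h2 : PreFrobenioid.IsIsometry C0.toElem g.hom.hom.hom.hom.fst :=
          (PreFrobenioid.isIsometry_fiberProduct_iff _).1 g.hom.hom.hom.property
        exact MorphismProperty.comp_mem (PreFrobenioid.isometricMorphisms C0.toElem) _ _ h1 h2
      · change C0.degFr (inv f.hom.hom.hom.hom.fst ≫ g.hom.hom.hom.hom.fst) = 1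
        rw [C0.degFr_comp', C0.degFr_inv, one_mul]
        exact g.hom.hom.property
  · -- second kind: at most one class
    refine Set.Subsingleton.finite ?_
    rintro x ⟨f, ⟨hf₂, hf⟩, rfl⟩ y ⟨g, ⟨hg₂, hg⟩, rfl⟩
    haveI := hf₂
    haveI := hg₂
    obtain ⟨hfi, -⟩ := N.isNaivelyIsotropic_of_irreducible f.hom hf
    obtain ⟨hgi, -⟩ := N.isNaivelyIsotropic_of_irreducible g.hom hg
    have hfr : (π.obj f.right.obj.obj.obj.snd).IsComplex :=
      (N.complexObjects_iff π f.right.obj).mp f.right.property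
    have hgr : (π.obj g.right.obj.obj.obj.snd).IsComplex :=
      (N.complexObjects_iff π g.right.obj).mp g.right.property
    -- the comparison arrow of `C₀` between the two isotropic codomains
    set κ := f.hom.hom.hom.hom.fst with hκ
    set κ' := g.hom.hom.hom.hom.fst with hκ'
    have hdeg : C0.degFr κ = 1 := f.hom.hom.property
    have hdeg' : C0.degFr κ' = 1 := g.hom.hom.property
    have hisoκ : ‖(C0.scalar κ : ℂ)‖ * X.obj.obj.fst.tip = f.right.obj.obj.obj.fst.tip := by
      have h := (A0.isIsometry_iff_norm_mul_tip_pow κ).mp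
        ((PreFrobenioid.isIsometry_fiberProduct_iff _).1 f.hom.hom.hom.property)
      rwa [hdeg, PNat.one_coe, pow_one] at h
    have hisoκ' : ‖(C0.scalar κ' : ℂ)‖ * X.obj.obj.fst.tip = g.right.obj.obj.obj.fst.tip := by
      have h := (A0.isIsometry_iff_norm_mul_tip_pow κ').mp
        ((PreFrobenioid.isIsometry_fiberProduct_iff _).1 g.hom.hom.hom.property)
      rwa [hdeg', PNat.one_coe, pow_one] at h
    haveI : IsIso (C0.Base κ) :=
      D0.isIso_of_isComplex_target _ (N.isComplex_fst_base π f.right.obj hfr)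
    haveI : IsIso (C0.Base κ') :=
      D0.isIso_of_isComplex_target _ (N.isComplex_fst_base π g.right.obj hgr)
    have htip : absHom ℂ (C0.scalar κ) * X.obj.obj.fst.region.tip = f.right.obj.obj.obj.fst.region.tip := by
      apply Subtype.ext; rw [Positive.val_mul, coe_absHom]; exact hisoκ
    have htip' : absHom ℂ (C0.scalar κ') * X.obj.obj.fst.region.tip = g.right.obj.obj.obj.fst.region.tip := by
      apply Subtype.ext; rw [Positive.val_mul, coe_absHom]; exact hisoκ'
    obtain ⟨A', hA'c, hA't, -, hA'i⟩ :=
      exists_pulledRegion g.right.obj.obj.obj.fst (inv (C0.Base κ) ≫ C0.Base κ')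
    have hsc : D0.scalars f.right.obj.obj.obj.fst.base = ⊤ := by
      rw [show f.right.obj.obj.obj.fst.base = D0.complex from N.isComplex_fst_base π f.right.obj hfr]
      exact D0.scalars_complex
    let tc : f.right.obj.obj.obj.fst ⟶ g.right.obj.obj.obj.fst :=
      { base := inv (C0.Base κ) ≫ C0.Base κ'
        degFr := 1
        scalar := (C0.Base κ).act (C0.scalar κ' * (C0.scalar κ)⁻¹)
        scalar_mem := by rw [hsc]; exact Subgroup.mem_top _
        mapsTo := by
          change (C0.Base κ).act (C0.scalar κ' * (C0.scalar κ)⁻¹) •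
              f.right.obj.obj.obj.fst.region.carrier ^ (0 + 1) ⊆
            C0.pullRegion g.right.obj.obj.obj.fst (inv (C0.Base κ) ≫ C0.Base κ')
          rw [← hA'c, AngularRegion.smul_carrier_pow_subset_iff, zero_add, pow_one, pow_one,
            show A'.dir = Set.univ from hA'i hgi, hA't]
          refine ⟨Set.subset_univ _, le_of_eq ?_⟩
          rw [C0.absHom_galAct, map_mul, map_inv, ← htip', ← htip, mul_assoc, inv_mul_cancel_left] }
    have hcomp : κ ≫ tc = κ' := by
      refine C0.hom_ext ?_ ?_ ?_
      · rw [C0.base_comp']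
        exact IsIso.hom_inv_id_assoc _ _
      · rw [C0.degFr_comp', hdeg, hdeg']; rfl
      · rw [C0.scalar_comp']
        change (C0.Base κ).act ((C0.Base κ).act (C0.scalar κ' * (C0.scalar κ)⁻¹)) *
          C0.scalar κ ^ ((1 : ℕ+) : ℕ) = C0.scalar κ'
        change D0.galAct _ (D0.galAct _ _) * _ = _
        rw [D0.galAct_galAct, PNat.one_coe, pow_one, inv_mul_cancel_right]
    have htciso : ‖(C0.scalar tc : ℂ)‖ * f.right.obj.obj.obj.fst.tip ^ (C0.degFr tc : ℕ) =
        g.right.obj.obj.obj.fst.tip := by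
      change ‖((D0.galAct _ (C0.scalar κ' * (C0.scalar κ)⁻¹) : ℂˣ) : ℂ)‖ *
        f.right.obj.obj.obj.fst.tip ^ ((1 : ℕ+) : ℕ) = _
      have hc : 0 < ‖(C0.scalar κ : ℂ)‖ := norm_pos_iff.mpr (C0.scalar κ).ne_zero
      rw [D0.norm_galAct, PNat.one_coe, pow_one, Units.val_mul, norm_mul, Units.val_inv_eq_inv_val,
        norm_inv, ← hisoκ, ← hisoκ']
      field_simp
    haveI : IsIso tc := C0.isIso_of_isIsotropic tc hfi rfl htciso
    obtain ⟨i⟩ := N.nonempty_under_iso f g (asIso tc) hcomp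
      ((A0.isIsometry_iff_norm_mul_tip_pow tc).mpr htciso) rfl
      ((asIso f.hom.hom.hom.hom.snd).symm ≪≫ asIso g.hom.hom.hom.hom.snd)
      (by rw [Iso.trans_hom, Iso.symm_hom, asIso_inv, asIso_hom, IsIso.hom_inv_id_assoc])
    exact Quotient.sound ⟨i⟩

/-! ### The repaired Proposition 3.5 (iii) for `N` (Galois-saturated base data) -/

/-- **The lift `B` ([FrdII] Prop. 3.5 (i) for `N`, abc-iut-w4-d100's `QuotientLiftN.liftObjN`) of an
RC-subanchor `B_D` of `D` is an RC-subanchor of `N`**: an arrow `B_D → C_D` to an RC-anchor lifts to the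
linear isometry `((id, 1, 1), B_D → C_D)` into `(B₀, C_D)`, an RC-anchor of `N` by
`N.isRCAnchor_of_isRCAnchor_base`. [cite: MochizukiFrdII2008, Prop 3.5 (iii) p.34] -/
theorem N.isRCSubanchor_liftObjN (Q : N π) {BD : D} (fD : BD ⟶ Q.obj.obj.snd)
    (hB : RC.IsRCSubanchor (baseRC π) BD) :
    RC.IsRCSubanchor (N.toC π ⋙ PreFrobenioid.baseFunctor (C.toElem π) ⋙ baseRC π)
      (QuotientLiftN.liftObjN π Q fD) := by
  obtain ⟨CD, hCD, ⟨h⟩⟩ := hB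
  obtain ⟨hCc', -⟩ := id hCD
  have hCc : (π.obj CD).IsComplex := (D0.isComplex_toArchBase_iff _).mp hCc'
  haveI hι : IsIso (π.map h) := D0.isIso_of_isComplex_target _ hCc
  let B' : C π := ⟨(QuotientLiftN.liftObjN π Q fD).obj.obj.fst, CD, @asIso _ _ _ _ (π.map h) hι⟩
  let k : (QuotientLiftN.liftObjN π Q fD).obj.obj ⟶ B' := ⟨𝟙 _, h, by
    rw [CategoryTheory.Functor.map_id, Category.id_comp]
    exact (Category.id_comp _).symm⟩
  have hk : PreFrobenioid.isometricMorphisms (C.toElem π) k :=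
    C.isIsometry_of_div_fst_eq_one π k (C0.div_id _)
  let kN : QuotientLiftN.liftObjN π Q fD ⟶ (⟨⟨B'⟩⟩ : N π) :=
    ⟨⟨k, hk⟩, C0.degFr_id' (QuotientLiftN.liftObjN π Q fD).obj.obj.fst⟩
  exact ⟨⟨⟨B'⟩⟩, N.isRCAnchor_of_isRCAnchor_base π ⟨⟨B'⟩⟩ hCD, ⟨kN⟩⟩

/-- **[FrdII] Proposition 3.5 (iii) for the non-rigidified angloid `N`, REPAIRED** (row G-w4d027-1 of
the cell's GAP-LEDGER; the typed `Prop35iii_N` is false, `ArchFrd.not_prop35iii_N_collapse`): if every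
object of `D` is a mono-minimal categorical quotient of an RC-subanchor of `D` by a GALOIS-SATURATED group
(the base functor `π` reflects the automorphisms needed, `ArchFrd.GaloisSaturated`), then `N` is of
RC-iso-subanchor type w.r.t. `N → C → D → D₀`, for every base `π : D → D₀`. Lift = abc-iut-w4-d100's
`QuotientLiftN` ([FrdII] Prop. 3.5 (i) repaired); RC-subanchor by `N.isRCSubanchor_liftObjN`.
[cite: MochizukiFrdII2008, Prop 3.5 (iii) p.34] -/
theorem prop35iii_N_of_saturated
    (hD : ∀ AD : D, ∃ (BD : D) (GD : Subgroup (Aut BD)) (fD : BD ⟶ AD),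
      RC.IsRCSubanchor (baseRC π) BD ∧ IsMonoMinimalQuotient GD fD ∧ GaloisSaturated π fD GD) :
    RC.IsOfRCIsoSubanchorType (N.toC π ⋙ PreFrobenioid.baseFunctor (C.toElem π) ⋙ baseRC π) := by
  refine ⟨fun Q => ?_⟩
  obtain ⟨BD, GD, fD, hB, hq, hsat⟩ := hD Q.obj.obj.snd
  exact ⟨QuotientLiftN.liftObjN π Q fD, (QuotientLiftN.liftAutHomN π Q fD GD hq.1.1).range,
    QuotientLiftN.liftMorN π Q fD, N.isRCSubanchor_liftObjN π Q fD hB,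
    QuotientLiftN.isMonoMinimalQuotient_liftMorN π Q fD hq hsat⟩

end ArchFrd

end

end Literature.AlgebraicGeometry.Frobenioids
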